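import Mathlib
import HarnessLib
import Summits.HubbardSuperconductivity.HubbardSuperconductivity.Theorems.KLProgrammeKLRegimeSplitGenericV2
import Summits.HubbardSuperconductivity.HubbardSuperconductivity.Theorems.KLProgrammeKLRegimeTwoPointLimitShellGainProfiles

/-!
# Route `KLProgramme` — crux K3 child 3 = ENGINE `KLRegimeEngineV7` (stmt-HubbardSuperconductivity-19662): the NAMED engine package
# `klEngGeo`, `klEngQ P R`, `klEngU₀ P R c`, `klEngL₃`, `klEngM₃` of the registered birth skeleton (cell gate-hubbard-kl, seat hubbard-kl-k3c2-p1)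
# (+ addendum: the regime threshold `klEngC₃ P R` of the gen-3 form `EngineP4`, Δ17)

`KLRegimeEngineV7 = EngineP3 klPredsV7 klWindowC` is `∃ G, G.WF ∧ ∀ P, P.WF → ∀ R, R.WF2 → ∃ Q, Q.WF ∧ ∀ c > 0, ∃ U₀ > 0, ∃ L₃ M₃, ∀ … ∀ n ≤ n_β + 1,
HistP … n → engine n ∧ twoLeg n`: the scale-`0` rung and the inductive scales must hold for THE SAME witnesses (`HistP` carries `Q` in the
hypothesis, so two independently proved `∃`-statements do not merge — plan g10, HOME/STATUS 2026-08-26T16:10:09Z).  Hence the skeleton registered on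
the item (`…Theorems.EngineV7.KLRegimeEngineV7_of`, stubs `stub_engine_wf`, `stub_engine_scale0`, `stub_twoLeg_scale0`, `stub_engine_step`,
`stub_twoLeg_step`) NAMES the package, and the stubs are stated AT it.  This module is that package as tree data, so that the stub files and the
skeleton refer to the same constants, together with the registered stub (S) `stub_engine_wf` PROVED (the package is well formed: the
gain profiles are summable as `GeoConsts.WF` demands, `Q`'s constants are even powers, `U₀ > 0`).  Definitions (numbers) + that proof; nothing
about the model is asserted.  If a stub prover needs larger
numbers the package is re-issued under new names and the skeleton re-registered (the route item is untouched).

THE NUMBERS.  `klEngGeo : GeoConsts` — block data `atop χ = 4`, `abot χ = 16`; one-scale bubble-mass window `[1/4, 4]` (≈ `ln 4` in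
`cooperMatrix`'s normalisation); localisation slack `cloc = 64` at rate `θ = 1/2`; Kohn–Luttinger drive `a χ = 16` with profile `ζ n = 4^{-n}`,
`Z = 2`, `aplus = 16`; bubble GAINS with the physical profiles: particle–particle `ppGain n ρ = 16·min(1, 4^{-n}/max(ρ, 4^{-n}))` — `16`
while the transfer `ρ` is below the scale, `16·4^{-n}/ρ` after, summable over the scales `n > t` once `ρ > 4^{-(t+1)}` (`Σ ≤ 64/3`) and NOT
at `ρ = 0` (the Cooper logarithm lives in the ladder step, not in the gains); particle–hole `phGain n ρ = 16·(4^{-n} + min(4ⁿ|ρ|, (4ⁿ|ρ|)⁻¹))`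
— summable uniformly in `ρ` (`Σ ≤ 64`: E.2's zero-transfer cancellation leaves the geometric `4^{-n}`, and a transfer `|ρ| ≍ 4^{-m}` is seen at
`O(1)` only by the scales `n ≈ m`); `CF = 128`; `cE4 = S j = Bf = SL = 64`.  `klEngQ P R : EngConsts` — every engine constant
`2^{20}·r⁴·p⁴` with `p = Klam + C_W + Cd` (`klEngP`), `r = 1 + cr + cz + Σ_{j ≤ 4} Gfr j` (`klEngR`; the frame's pieces sit in the
propagators, so `Q` reads `R` — `Q` is chosen after `R` in `EngineP3`); `CL β n = 2^{20} r⁴ p⁴ (1 + β²) 4ⁿ`; `L0 β = ⌈β⌉₊² + 2`;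
`M0 β L = (⌈β⌉₊ + L)⁴`.  `klEngU₀ P R c = (2^{40} r⁸ p⁸ (1 + c))⁻¹`.  Thresholds `klEngL₃ β U = ⌈β⌉₊² + 2` (so `β ≤ L`: the infrared Gram
constant of the scale-`0` step is β-uniform only for `L ≳ β` — de Siqueira Pedra–Salmhofer 2008, Lemma 5.1, the term
`∫|φ| ln(1/max{|E|, π/β})`) and `klEngM₃ β U L = (⌈β⌉₊ + L)⁴` (so `M ≥ β²`, `M ≥ L²`).
-/

noncomputable section

namespace Summit.HubbardSuperconductivity.HubbardSuperconductivity.Theorems.EngineV7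

set_option linter.dupNamespace false -- summit = problem name (single-conjunct summit), D-0017

open Real Finset
open Summit.HubbardSuperconductivity.HubbardSuperconductivity.Theorems.KLRegimeSplit

/-- **`G` of the engine** — the absolute constants the engine commits to: block data `4`/`16`, bubble window `[1/4, 4]`, slack `64` at rate
`1/2`, drive `16·4^{-n}` (`Z = 2`, `aplus = 16`), gains `ppGain n ρ = 16·min(1, 4^{-n}/max(ρ, 4^{-n}))`,
`phGain n ρ = 16·(4^{-n} + min(4ⁿ|ρ|, (4ⁿ|ρ|)⁻¹))`, `CF = 128`, `cE4 = S j = Bf = SL = 64`. -/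
def klEngGeo : GeoConsts where
  atop := fun _ => 4
  abot := fun _ => 16
  blo := 1 / 4
  bhi := 4
  cloc := 64
  θ := 1 / 2
  a := fun _ => 16
  ζ := fun n => ((4 : ℝ) ^ n)⁻¹
  Z := 2
  aplus := 16
  ppGain := fun n ρ => 16 * min 1 (((4 : ℝ) ^ n)⁻¹ / max ρ ((4 : ℝ) ^ n)⁻¹)
  phGain := fun n ρ => 16 * (((4 : ℝ) ^ n)⁻¹ + min ((4 : ℝ) ^ n * |ρ|) ((4 : ℝ) ^ n * |ρ|)⁻¹)
  CF := 128
  cE4 := 64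
  S := fun _ => 64
  Bf := 64
  SL := 64

/-- The size of the induction constants read by the engine's `Q`: `p = Klam + C_W + Cd` (`≥ 1` for well-formed `P`). -/
def klEngP (P : SplitConsts) : ℝ := P.Klam + P.C_W + P.Cd

/-- The size of the renormalisation package read by the engine's `Q`: `r = 1 + cr + cz + Σ_{j ≤ 4} Gfr j` (`≥ 1` for well-formed `R`). -/
def klEngR (R : RenConsts) : ℝ := 1 + R.cr + R.cz + ∑ j ∈ range 5, R.Gfr j

/-- **`Q` of the engine** at `(P, R)`: every constant `2^{20}·r⁴·p⁴`; `CL β n = 2^{20} r⁴ p⁴ (1 + β²) 4ⁿ`; `L0 β = ⌈β⌉₊² + 2`;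
`M0 β L = (⌈β⌉₊ + L)⁴`. -/
def klEngQ (P : SplitConsts) (R : RenConsts) : EngConsts where
  CE := 2 ^ 20 * klEngR R ^ 4 * klEngP P ^ 4
  CR := 2 ^ 20 * klEngR R ^ 4 * klEngP P ^ 4
  c0 := 2 ^ 20 * klEngR R ^ 4 * klEngP P ^ 4
  cE4 := 2 ^ 20 * klEngR R ^ 4 * klEngP P ^ 4
  S' := fun _ => 2 ^ 20 * klEngR R ^ 4 * klEngP P ^ 4
  Bf := 2 ^ 20 * klEngR R ^ 4 * klEngP P ^ 4
  SL := 2 ^ 20 * klEngR R ^ 4 * klEngP P ^ 4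
  CL := fun β n => 2 ^ 20 * klEngR R ^ 4 * klEngP P ^ 4 * (1 + β ^ 2) * (4 : ℝ) ^ n
  L0 := fun β => ⌈β⌉₊ ^ 2 + 2
  M0 := fun β L => (⌈β⌉₊ + L) ^ 4

/-- **`U₀` of the engine** at `(P, R, c)`: `(2^{40} r⁸ p⁸ (1 + c))⁻¹`. -/
def klEngU₀ (P : SplitConsts) (R : RenConsts) (c : ℝ) : ℝ := (2 ^ 40 * klEngR R ^ 8 * klEngP P ^ 8 * (1 + c))⁻¹

/-- **The engine's volume threshold** `L₃ β U = ⌈β⌉₊² + 2` (in particular `β ≤ L`). -/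
def klEngL₃ (β _U : ℝ) : ℕ := ⌈β⌉₊ ^ 2 + 2

/-- **The engine's Matsubara threshold** `M₃ β U L = (⌈β⌉₊ + L)⁴` (in particular `β² ≤ M` and `L² ≤ M`). -/
def klEngM₃ (β _U : ℝ) (L : ℕ) : ℕ := (⌈β⌉₊ + L) ^ 4

/-! ## Unfolding lemmas (`rfl`) -/

/-- The common size `2^{20} r⁴ p⁴` of the engine's constants. -/
theorem klEngQ_CE (P : SplitConsts) (R : RenConsts) : (klEngQ P R).CE = 2 ^ 20 * klEngR R ^ 4 * klEngP P ^ 4 := rfl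

/-- The finite-volume error constant of the package. -/
theorem klEngQ_CL (P : SplitConsts) (R : RenConsts) (β : ℝ) (n : ℕ) :
    (klEngQ P R).CL β n = 2 ^ 20 * klEngR R ^ 4 * klEngP P ^ 4 * (1 + β ^ 2) * (4 : ℝ) ^ n := rfl

/-- The Matsubara threshold of the package's `Q`. -/
theorem klEngQ_M0 (P : SplitConsts) (R : RenConsts) (β : ℝ) (L : ℕ) : (klEngQ P R).M0 β L = (⌈β⌉₊ + L) ^ 4 := rfl

/-- The particle–particle gain profile. -/
theorem klEngGeo_ppGain (n : ℕ) (ρ : ℝ) :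
    klEngGeo.ppGain n ρ = 16 * min 1 (((4 : ℝ) ^ n)⁻¹ / max ρ ((4 : ℝ) ^ n)⁻¹) := rfl

/-- The particle–hole gain profile. -/
theorem klEngGeo_phGain (n : ℕ) (ρ : ℝ) :
    klEngGeo.phGain n ρ = 16 * (((4 : ℝ) ^ n)⁻¹ + min ((4 : ℝ) ^ n * |ρ|) ((4 : ℝ) ^ n * |ρ|)⁻¹) := rfl

/-- `β ≤ L` beyond the engine's volume threshold. -/
theorem le_of_klEngL₃_le {β U : ℝ} {L : ℕ} (h : klEngL₃ β U ≤ L) : β ≤ L := by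
  unfold klEngL₃ at h
  have h1 : β ≤ (⌈β⌉₊ : ℝ) := Nat.le_ceil β
  have h2 : (⌈β⌉₊ : ℝ) ≤ (⌈β⌉₊ : ℝ) ^ 2 + 2 := by nlinarith [sq_nonneg ((⌈β⌉₊ : ℝ) - 1)]
  have h3 : ((⌈β⌉₊ ^ 2 + 2 : ℕ) : ℝ) ≤ (L : ℝ) := by exact_mod_cast h
  push_cast at h3
  linarith

/-- `L² ≤ M` beyond the engine's Matsubara threshold. -/
theorem sq_le_of_klEngM₃_le {β U : ℝ} {L M : ℕ} (h : klEngM₃ β U L ≤ M) : L ^ 2 ≤ M := by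
  unfold klEngM₃ at h
  calc L ^ 2 ≤ (⌈β⌉₊ + L) ^ 2 := Nat.pow_le_pow_left (Nat.le_add_left _ _) 2
    _ ≤ (⌈β⌉₊ + L) ^ 4 := by
        rcases Nat.eq_zero_or_pos (⌈β⌉₊ + L) with h0 | hpos
        · simp [h0]
        · exact Nat.pow_le_pow_right hpos (by norm_num)
    _ ≤ M := h

/-! ## Well-formedness of the package = the registered stub (S) `stub_engine_wf` -/

/-- `Σ_{n ∈ Ioc t N} 4^{t+1}·4^{-n} ≤ 4/3` (the particle–particle gains beyond the transfer's own scale). -/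
theorem sum_Ioc_four_pow_mul_inv_le (t N : ℕ) : ∑ n ∈ Ioc t N, (4 : ℝ) ^ (t + 1) * ((4 : ℝ) ^ n)⁻¹ ≤ 4 / 3 := by
  rw [← Finset.Ico_add_one_add_one_eq_Ioc, Finset.sum_Ico_eq_sum_range]
  have h : ∀ k : ℕ, (4 : ℝ) ^ (t + 1) * ((4 : ℝ) ^ (t + 1 + k))⁻¹ = ((4 : ℝ) ^ k)⁻¹ := by
    intro k
    rw [pow_add (4 : ℝ) (t + 1) k, mul_inv, ← mul_assoc, mul_inv_cancel₀ (by positivity), one_mul]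
  simp only [h]
  exact klgp_sum_range_inv_four_pow_le _

/-- **The two-sided geometric profile is summable**: for `x ≥ 0` and any finite set of scales,
`Σ_n min(4ⁿx, (4ⁿx)⁻¹) ≤ 8/3` (the scales below the crossover `4ⁿx ≤ 1` contribute an increasing geometric sum `≤ 4/3`, those above a
decreasing one `≤ 4/3`). -/
theorem sum_min_geom_le {x : ℝ} (hx : 0 ≤ x) (s : Finset ℕ) :
    ∑ n ∈ s, min ((4 : ℝ) ^ n * x) ((4 : ℝ) ^ n * x)⁻¹ ≤ 8 / 3 := by
  classical
  set A := s.filter (fun n => (4 : ℝ) ^ n * x ≤ 1) with hA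
  set B := s.filter (fun n => ¬ ((4 : ℝ) ^ n * x ≤ 1)) with hB
  rw [← Finset.sum_filter_add_sum_filter_not s (fun n => (4 : ℝ) ^ n * x ≤ 1)]
  have hApart : ∑ n ∈ A, min ((4 : ℝ) ^ n * x) ((4 : ℝ) ^ n * x)⁻¹ ≤ 4 / 3 := by
    rcases A.eq_empty_or_nonempty with hAe | hAne
    · rw [hAe, sum_empty]; norm_num
    · have hn₁ : (4 : ℝ) ^ (A.max' hAne) * x ≤ 1 := (mem_filter.1 (A.max'_mem hAne)).2
      have hy : 0 ≤ (4 : ℝ) ^ (A.max' hAne) * x := by positivity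
      calc ∑ n ∈ A, min ((4 : ℝ) ^ n * x) ((4 : ℝ) ^ n * x)⁻¹ ≤ ∑ n ∈ A, (4 : ℝ) ^ n * x :=
            sum_le_sum fun n _ => min_le_left _ _
        _ ≤ ∑ n ∈ range (A.max' hAne + 1), (4 : ℝ) ^ n * x := by
            refine sum_le_sum_of_subset_of_nonneg (fun n hn => mem_range.2 (Nat.lt_succ_of_le (A.le_max' n hn))) ?_
            intro n _ _
            positivity
        _ = (∑ n ∈ range (A.max' hAne + 1), (4 : ℝ) ^ n) * x := by rw [sum_mul]
        _ = ((4 : ℝ) ^ (A.max' hAne + 1) - 1) / (4 - 1) * x := by rw [geom_sum_eq (by norm_num) (A.max' hAne + 1)]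
        _ = (4 / 3) * ((4 : ℝ) ^ (A.max' hAne) * x) - x / 3 := by ring
        _ ≤ 4 / 3 := by nlinarith
  have hBpart : ∑ n ∈ B, min ((4 : ℝ) ^ n * x) ((4 : ℝ) ^ n * x)⁻¹ ≤ 4 / 3 := by
    rcases B.eq_empty_or_nonempty with hBe | hBne
    · rw [hBe, sum_empty]; norm_num
    · set n₂ := B.min' hBne with hn₂def
      set n₃ := B.max' hBne with hn₃def
      have hn₂ : 1 < (4 : ℝ) ^ n₂ * x := not_le.1 (mem_filter.1 (B.min'_mem hBne)).2
      have hinv : ((4 : ℝ) ^ n₂ * x)⁻¹ ≤ 1 := inv_le_one_of_one_le₀ hn₂.le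
      calc ∑ n ∈ B, min ((4 : ℝ) ^ n * x) ((4 : ℝ) ^ n * x)⁻¹ ≤ ∑ n ∈ B, ((4 : ℝ) ^ n * x)⁻¹ :=
            sum_le_sum fun n _ => min_le_right _ _
        _ ≤ ∑ n ∈ Ico n₂ (n₃ + 1), ((4 : ℝ) ^ n * x)⁻¹ := by
            refine sum_le_sum_of_subset_of_nonneg
              (fun n hn => mem_Ico.2 ⟨B.min'_le n hn, Nat.lt_succ_of_le (B.le_max' n hn)⟩) ?_
            intro n _ _
            positivity
        _ = ∑ k ∈ range (n₃ + 1 - n₂), ((4 : ℝ) ^ (n₂ + k) * x)⁻¹ := Finset.sum_Ico_eq_sum_range _ _ _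
        _ = ∑ k ∈ range (n₃ + 1 - n₂), ((4 : ℝ) ^ n₂ * x)⁻¹ * ((4 : ℝ) ^ k)⁻¹ := by
            refine sum_congr rfl fun k _ => ?_
            rw [pow_add, mul_right_comm, mul_inv]
        _ = ((4 : ℝ) ^ n₂ * x)⁻¹ * ∑ k ∈ range (n₃ + 1 - n₂), ((4 : ℝ) ^ k)⁻¹ := by rw [mul_sum]
        _ ≤ 1 * (4 / 3) :=
            mul_le_mul hinv (klgp_sum_range_inv_four_pow_le _) (sum_nonneg fun k _ => by positivity) zero_le_one
        _ = 4 / 3 := one_mul _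
  linarith

/-- **`klEngGeo` is well formed** (`GeoConsts.WF`): signs, `θ = 1/2`, `blo ≤ bhi`, `Σ ζ ≤ Z`, and the freezing bounds of the gains —
`Σ_{n<N} phGain n ρ ≤ 64 ≤ CF` for every `ρ`, `Σ_{n ∈ Ioc t N} ppGain n ρ ≤ 64/3 ≤ CF` once `ρ > 4^{-(t+1)}`. -/
theorem klEngGeo_wf : klEngGeo.WF := by
  unfold GeoConsts.WF
  dsimp only [klEngGeo]
  refine ⟨fun _ => by norm_num, fun _ => by norm_num, by norm_num, by norm_num, by norm_num, by norm_num, by norm_num,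
    fun _ => by norm_num, fun n => by positivity, fun N => ?_, by norm_num, fun n ρ => ?_, fun n ρ => ?_, by norm_num,
    fun ρ N _ => ?_, fun ρ t N hρ => ?_, by norm_num, fun _ => by norm_num, by norm_num, by norm_num⟩
  · -- `Σ ζ ≤ Z`
    exact (klgp_sum_range_inv_four_pow_le N).trans (by norm_num)
  · -- `0 ≤ ppGain`
    have h4 : (0 : ℝ) < ((4 : ℝ) ^ n)⁻¹ := by positivity
    have hmax : (0 : ℝ) < max ρ ((4 : ℝ) ^ n)⁻¹ := lt_of_lt_of_le h4 (le_max_right _ _)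
    exact mul_nonneg (by norm_num) (le_min zero_le_one (div_nonneg h4.le hmax.le))
  · -- `0 ≤ phGain`
    exact mul_nonneg (by norm_num) (add_nonneg (by positivity) (le_min (by positivity) (by positivity)))
  · -- `Σ_{n<N} phGain n ρ ≤ CF`
    rw [← mul_sum, sum_add_distrib]
    have h1 := klgp_sum_range_inv_four_pow_le N
    have h2 := sum_min_geom_le (abs_nonneg ρ) (range N)
    linarith
  · -- `Σ_{n ∈ Ioc t N} ppGain n ρ ≤ CF` for `ρ > 4^{-(t+1)}`
    have hρ0 : 0 < ρ := lt_trans (by positivity) hρ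
    have hterm : ∀ n ∈ Ioc t N, 16 * min 1 (((4 : ℝ) ^ n)⁻¹ / max ρ ((4 : ℝ) ^ n)⁻¹) ≤
        16 * ((4 : ℝ) ^ (t + 1) * ((4 : ℝ) ^ n)⁻¹) := by
      intro n hn
      have hn' : t + 1 ≤ n := (mem_Ioc.1 hn).1
      have hle : ((4 : ℝ) ^ n)⁻¹ ≤ ((4 : ℝ) ^ (t + 1))⁻¹ := by
        gcongr
        · norm_num
      have hmax : max ρ ((4 : ℝ) ^ n)⁻¹ = ρ := max_eq_left (hle.trans hρ.le)
      rw [hmax]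
      refine mul_le_mul_of_nonneg_left ((min_le_right _ _).trans ?_) (by norm_num)
      rw [div_le_iff₀ hρ0]
      have h4n : (0 : ℝ) < ((4 : ℝ) ^ n)⁻¹ := by positivity
      have : ((4 : ℝ) ^ n)⁻¹ * 1 ≤ ((4 : ℝ) ^ n)⁻¹ * ((4 : ℝ) ^ (t + 1) * ρ) := by
        refine mul_le_mul_of_nonneg_left ?_ h4n.le
        have := mul_lt_mul_of_pos_left hρ (show (0 : ℝ) < (4 : ℝ) ^ (t + 1) by positivity)
        rw [mul_inv_cancel₀ (by positivity)] at this
        exact this.le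
      linarith
    calc ∑ n ∈ Ioc t N, 16 * min 1 (((4 : ℝ) ^ n)⁻¹ / max ρ ((4 : ℝ) ^ n)⁻¹)
        ≤ ∑ n ∈ Ioc t N, 16 * ((4 : ℝ) ^ (t + 1) * ((4 : ℝ) ^ n)⁻¹) := sum_le_sum hterm
      _ = 16 * ∑ n ∈ Ioc t N, (4 : ℝ) ^ (t + 1) * ((4 : ℝ) ^ n)⁻¹ := by rw [mul_sum]
      _ ≤ 16 * (4 / 3) := mul_le_mul_of_nonneg_left (sum_Ioc_four_pow_mul_inv_le t N) (by norm_num)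
      _ ≤ 128 := by norm_num

/-- `r ≥ 1` for a well-formed renormalisation package. -/
theorem one_le_klEngR {R : RenConsts} (hR : R.WF) : 1 ≤ klEngR R := by
  unfold klEngR
  obtain ⟨hcr, hcz, hG⟩ := hR
  have hs : 0 ≤ ∑ j ∈ range 5, R.Gfr j := sum_nonneg fun j _ => hG j
  linarith

/-- `p ≥ 1` for well-formed induction constants. -/
theorem one_le_klEngP {P : SplitConsts} (hP : P.WF) : 1 ≤ klEngP P := by
  unfold klEngP
  obtain ⟨hK, hW, hd⟩ := hP
  linarith

/-- **`klEngQ P R` is well formed** (`EngConsts.WF`; all constants are even powers times positive numerals). -/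
theorem klEngQ_wf (P : SplitConsts) (R : RenConsts) : (klEngQ P R).WF := by
  unfold EngConsts.WF
  dsimp only [klEngQ]
  refine ⟨by positivity, by positivity, by positivity, by positivity, fun _ => by positivity, by positivity, by positivity,
    fun β n => by positivity⟩

/-- **`klEngU₀ P R c > 0`** for well-formed `P`, `R` and `c ≥ 0`. -/
theorem klEngU₀_pos {P : SplitConsts} {R : RenConsts} (hP : P.WF) (hR : R.WF) {c : ℝ} (hc : 0 ≤ c) : 0 < klEngU₀ P R c := by
  unfold klEngU₀
  have hr : 0 < klEngR R := lt_of_lt_of_le one_pos (one_le_klEngR hR)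
  have hp : 0 < klEngP P := lt_of_lt_of_le one_pos (one_le_klEngP hP)
  positivity

/-- **STUB (S) `stub_engine_wf` of the registered skeleton, PROVED — the package is well formed**: `klEngGeo.WF`; for well-formed
`P`, `R`: `(klEngQ P R).WF` and `0 < klEngU₀ P R c` for every `c > 0`. -/
theorem stub_engine_wf :
    klEngGeo.WF ∧ ∀ (P : SplitConsts) (R : RenConsts), P.WF → R.WF2 →
      (klEngQ P R).WF ∧ ∀ c : ℝ, 0 < c → 0 < klEngU₀ P R c :=
  ⟨klEngGeo_wf, fun P R hP hR => ⟨klEngQ_wf P R, fun _ hc => klEngU₀_pos hP hR.wf hc.le⟩⟩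

/-! ## Addendum (gen-3 resplit, Δ17): the regime threshold `c₃` of `EngineP4` -/

/-- **`c₃` of the engine** at `(P, R)`: `(2^{20} r⁴ p⁴)⁻¹` — the regime threshold of `EngineP4` (`∃ Q, Q.WF ∧ ∃ c₃ > 0, ∀ c ≤ c₃, …`;
Δ17: the single-slice smallness at the deepest admissible scale is linear in `Klam(|U| + U²(n-1)) ≈ Klam(|U| + c/log 4)`, so the step
can only be certified for `c` below a `(P, R)`-dependent threshold, which the glue absorbs into K3's `∃ c`). -/
def klEngC₃ (P : SplitConsts) (R : RenConsts) : ℝ := (2 ^ 20 * klEngR R ^ 4 * klEngP P ^ 4)⁻¹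

/-- **`klEngC₃ P R > 0`** for well-formed `P`, `R`. -/
theorem klEngC₃_pos {P : SplitConsts} {R : RenConsts} (hP : P.WF) (hR : R.WF) : 0 < klEngC₃ P R := by
  unfold klEngC₃
  have hr : 0 < klEngR R := lt_of_lt_of_le one_pos (one_le_klEngR hR)
  have hp : 0 < klEngP P := lt_of_lt_of_le one_pos (one_le_klEngP hP)
  positivity

/-- **The package is well formed, gen-3 form** (what the `EngineP4` composition needs): `klEngGeo.WF`, and for well-formed `P`, `R`:
`(klEngQ P R).WF`, `0 < klEngC₃ P R`, and `0 < klEngU₀ P R c` for every `c ≥ 0`. -/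
theorem klEng_package_wf :
    klEngGeo.WF ∧ ∀ (P : SplitConsts) (R : RenConsts), P.WF → R.WF2 →
      (klEngQ P R).WF ∧ 0 < klEngC₃ P R ∧ ∀ c : ℝ, 0 ≤ c → 0 < klEngU₀ P R c :=
  ⟨klEngGeo_wf, fun P R hP hR => ⟨klEngQ_wf P R, klEngC₃_pos hP hR.wf, fun _ hc => klEngU₀_pos hP hR.wf hc⟩⟩

end Summit.HubbardSuperconductivity.HubbardSuperconductivity.Theorems.EngineV7

end
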